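import Summits.QuantumFields.YangMills.Theorems.BalabanUVNodesN15TwoSpacingGluingCurvedKnitGradientDefect
import Summits.QuantumFields.YangMills.Theorems.BalabanUVNodesN15TwoSpacingGluingCurvedKnitSmallFieldDefect
import HarnessLib

/-!
# THE GLUING STEP AT TWO LATTICE SPACINGS — THE GRADIENT ENTRIES OF THE GLUED LIVE-BACKGROUND PROPAGATOR, V: THE TWO-SPACING η-DEFECT OF EVERY FLAT JET COMPONENT OF THE LIVE GLUED
# PROPAGATORS IN THE GLOBAL SMALL-FIELD GAUGE, EVERY ROW DISCHARGED — `𝔇_π̂(∇′_j𝒢′_{U′}, ∇_j𝒢_U) ≤ D((L^k)^{−1∕16} + c·η)·e^{−(δ∕16)d}` for skew-Hermitian potentials in the C² window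
# (dag-n15-c g17, FILE 139 — FILE 130's twin for the gradient entries of (3.42); N15 = NE2, s1 «background-layer OPERATOR ingredient»)

Cell `pub-ymgap`, seat `pub-ymgap-dag-n15-c` (R134 (a); HUMAN RULING D-0062), generation 17.  `bears_on: R4∕N15 · K3⁸ SpineGivenEndpointR13SepCoPHV (stmt-QuantumFields-27366)`.
Filed `--kind proof --supports stmt-QuantumFields-27366 --as helper` — COUNT-NEUTRAL.  Theorems only; 0 `def`, 0 `sorry`.  Imports BY NAME FILE 138 `…CurvedKnitGradientDefect` (`one_idef_jet_cvGlued`)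
and FILE 130 `…CurvedKnitSmallFieldDefect` (`hasMaj_idef_sandwich_zero`, `rowFit_smul_of_rowFit(₂)`, `gavgM_conjTranspose_of_skew`, `conj_one_exp_eq_expTrField`; through it FILE 129
`conj_one_eq_sub_zero`, `hasMaj_sandwich_zero`, dag-n15-w2 `twoSidedLetters_curvCoef_one_of_meanGauge`, `curvCoefC_one`, `curvCoefA_one`, `coordMat_adCLM_transpose_eq_neg_of_conjTranspose`).
Nothing in the tree is modified.

WHY ∕ WHAT.  FILE 130 `sf_idef_cvGlued` discharged all eighteen displayed rows of FILE 123 (entry 0 of the live-background family) from the skew-Hermitian C²-window class in the GLOBAL gauge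
(`w ≡ 1`, `U := e^{ηA}`, `P := N_L ⊗ 1`, `N_V := 0`; species rows and fits = conjuncts 1–6 of dag-n15-w2's fifteen `TwoSidedLetters` for the pair (`A′`, `Ā′ = gavgM π̂ A′`) at rate
`θ = η`).  FILE 138 `one_idef_jet_cvGlued` displays the SAME sixteen rows (no gauge fit) for the η-defect of every flat jet component `∇^±_μ` of the glued pair.  ★★★ `sf_idef_jet_cvGlued`: 130's
discharge verbatim applied to 138 — for every jet index `j`, `𝔇_π̂(∇′_j ∘ cvGlued′ … 1 e^{η′A′} (N′_L ⊗ 1) 0, ∇_j ∘ cvGlued … 1 e^{ηĀ′} (N_L ⊗ 1) 0) ≤ D·((L^k)^{−1∕16} + scale·(1+|J⊕J|)·η)·e^{−(δ∕16)|y−y′|}`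
blockwise, `scale = 14e(2+d)κ_e(2+d)(5+2d)r_A`, `η = L^{−k}` — the gradient entries 1–2 of [Balaban1985BackgroundPropagators] (3.42) for the model family, with NO displayed row.

HONEST FRAMING ∕ LIMITS.  Assembly of LANDED theorems (one `obtain` of 138's constants, one of the fifteen letters, currency rewrites, one application) + finite-dimensional algebra;
MODEL operator (covariant Laplacian (3.50) ⊗ colour of `Ad_{e^{ηA}}` + the FLAT nonlocal part of [B4-I] (1.69) — NOT Bałaban's `Δ_a(U)` (3.26)); MODEL class (global gauge; all mixed
second differences); MODEL pairing (coarse field := King block mean of the fine one); MODEL carriers; the FLAT jet `∇^±_μ` (the covariant correction `M_a𝒢` of `∇_U` is a bounded letter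
times entry 0 — located, not here); constants crude.  The η-RATE inequality of this kind is NOT PRINTED ([B9] Thm 3.14 is the DOMAIN-difference template); nothing of [B5]∕[B6]∕[B9] asserted.
NE2⁺ NOT PRINTED, NOT proved; N15 NOT discharged; K3⁸ OPEN, skeleton v6 untouched (0∕2); counts of record UNMOVED (typed 28∕28 · discharged 5∕27 · A 5∕28); one finite 𝕋⁴ at fixed ε — NOT
infinite volume, NOT OS on ℝ⁴, NOT a mass gap, NOT Clay; R4 closes the conditional finite-𝕋⁴ rung `BalabanLadder.UV` only.  Restate-immune (no Theses import).
-/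

noncomputable section

open scoped BigOperators Matrix Matrix.Norms.Frobenius

namespace Summit.QuantumFields.YangMills.BalabanUVNodes.N15.Gluing

open Literature.MathematicalPhysics.QuantumFieldTheory.Balaban1983to89
open Literature.MathematicalPhysics.QuantumFieldTheory.Balaban1983to89.B11SectG (BlockNorm HasMaj)
open Literature.MathematicalPhysics.QuantumFieldTheory.Balaban1983to89.T4EtaRateDefect (idef)
open Literature.MathematicalPhysics.QuantumFieldTheory.Balaban1983to89.T4EtaRateCoeffDefect (pull)
open Literature.MathematicalPhysics.QuantumFieldTheory.Balaban1983to89.B6Prop26Gluing (mulOp)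
open Literature.MathematicalPhysics.QuantumFieldTheory.Balaban1983to89.B6UnitTorusCarrier (unitTorusGeo unitTorusGeo_dist_nonneg)
open Literature.MathematicalPhysics.QuantumFieldTheory.King1986.Torus (blockOf)
open Literature.Barriers.QuantumFields (traceForm)
open Literature.MathematicalPhysics.QuantumFieldTheory.Balaban1983to89.Beta.AveragingCorrectionJets (adCLM)
open Summit.QuantumFields.YangMills.BalabanUVNodes.N15.BackgroundLayer (covLapM tCoefA tCoefC gavgM fgrad bgrad)
open Summit.QuantumFields.YangMills.BalabanUVNodes.N15.VectorPiece (bshiftEquiv kingPrV kingPrV_bshiftEquiv_pow fibre_conn_kingPrV bshiftEquiv_comm)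
open Summit.QuantumFields.YangMills.BalabanUVNodes.N15.MatrixSpecies (mmulOp coordMat basisConst basisConst_nonneg liftBlk liftMap liftEquiv blockAvgV Phi0)
open Summit.QuantumFields.YangMills.BalabanUVNodes.N15.TwoGrid (chiCube abs_chiCube_le_one chiCube_kingPrV)
open Summit.QuantumFields.YangMills.BalabanUVNodes.N15.CurvedSpecies (gaugePair expTrField expTrField_apply curvCoefC_one curvCoefA_one twoSidedLetters_curvCoef_one_of_meanGauge
  coordMat_adCLM_transpose_eq_neg_of_conjTranspose Phi0_adCLM_eq_mulLeftRight conjTranspose_exp_smul_of_conjTranspose)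

variable {d : ℕ}

/-! ## §1 The two-spacing η-defect of every flat jet component of the live-background glued propagators, every row produced -/

section Defect

variable {L : ℕ} [NeZero L]

set_option maxHeartbeats 800000 in
/-- ★★★ **THE η-DEFECT OF EVERY FLAT JET COMPONENT OF THE LIVE-BACKGROUND GLUED PROPAGATORS AT THE COVER IN THE GLOBAL SMALL-FIELD GAUGE — FILE 138 `one_idef_jet_cvGlued` WITH ALL
SIXTEEN ROWS DISCHARGED** (FILE 130's twin for the gradient entries).  For odd
`L ≥ 7`, `a > 0`, a colour index `ι`: there are `δ, R₀ > 0`, `w₀`, `D` such that on every doubled torus `2L·L^m` of the cover (`k ≥ 1`, `L^m ≥ w₀`) and every refinement `r`, for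
trace-form coordinates `e` of `𝔲(m)`, EVERY SKEW-HERMITIAN gauge potential `A′` on the FINE bonds in the C² small-field window at scale `r_A` (sup `≤ r_A`, all one-step differences
`≤ r_Aη′`, all mixed second differences `≤ r_Aη′²`, `η′ = (L^rL^k)^{−1}`) with `2(2+d)(5+2d)r_A ≤ 1` and `scale·(1 + |J ⊕ J|) ≤ R₀`: the η-defect along King's bond pairing `π̂` between
the FINE glued operator (transporters `Ad_{e^{η′A′}}`, gauges `1`, summand `N′_L ⊗ 1`, perturbation `0`) and the COARSE one for the block mean `Ā′ = gavgM π̂ A′` (transporters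
`Ad_{e^{ηĀ′}}`, `η = L^{−k}`) satisfies `𝔇 ≤ D·((L^k)^{−1∕16} + scale·(1+|J⊕J|)·η)·e^{−(δ∕16)|y−y′|}` blockwise, `scale = 14e(2+d)κ_e(2+d)(5+2d)r_A` — an η-RATE with NO displayed
row — here for `∇′_j ∘ 𝒢′` against `∇_j ∘ 𝒢`, every jet index `j = ±μ` (the flat jets `fgrad`∕`bgrad` of the cover's bond shifts lifted to the colour).  MODEL operator ∕ class ∕ pairing ∕
carriers; FLAT jet; NOT [B9] Thm 3.14 (domain differences) and not any printed estimate.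
[cite: Balaban1985BackgroundPropagators, (3.42) p.397 (gradient entries: shape), Thm 3.14 pp.426–427 (template), (3.35)–(3.37) p.396, (3.50)–(3.52) p.400, (3.62)–(3.65) pp.402–403; King1986, p.664 (pairing), Prop. 3.9 (3.73) p.665 (rate shape); Balaban1984PropagatorsII, (2.133)–(2.136) p.247] -/
theorem sf_idef_jet_cvGlued (hL : Odd L ∧ 1 < L) (hL7 : 7 ≤ L) {a : ℝ} (ha : 0 < a) (ι : Type) [Fintype ι] [DecidableEq ι] :
    ∃ δ w₀ R₀ D : ℝ, 0 < δ ∧ 0 < R₀ ∧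
      ∀ (mv kk r : ℕ) (j : Fin (d + 1) ⊕ Fin (d + 1)), 1 ≤ kk → w₀ ≤ ((L ^ mv : ℕ) : ℝ) →
      ∀ {mm : Type} [Fintype mm] [DecidableEq mm] (e : Matrix mm mm ℂ ≃L[ℝ] (ι → ℝ)), (∀ A B : Matrix mm mm ℂ, traceForm A B = e A ⬝ᵥ e B) →
      ∀ (A' : Fin (d + 1) → CvX' d L mv kk r hL → Matrix mm mm ℂ), (∀ μ x', (A' μ x')ᴴ = -A' μ x') →
      ∀ (rA : ℝ), 0 ≤ rA → (∀ μ x', ‖A' μ x'‖ ≤ rA) →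
        (∀ μ κ x', ‖A' μ (bshiftEquiv (cvM d L mv kk hL) (L ^ r * L ^ kk) κ x') - A' μ x'‖ ≤ rA * ((((L ^ r * L ^ kk : ℕ) : ℝ))⁻¹)) →
        (∀ μ κ x', ‖(A' μ (bshiftEquiv (cvM d L mv kk hL) (L ^ r * L ^ kk) κ x') - A' μ x') -
            (A' μ (bshiftEquiv (cvM d L mv kk hL) (L ^ r * L ^ kk) κ ((bshiftEquiv (cvM d L mv kk hL) (L ^ r * L ^ kk) μ).symm x')) -
              A' μ ((bshiftEquiv (cvM d L mv kk hL) (L ^ r * L ^ kk) μ).symm x'))‖ ≤ rA * ((((L ^ r * L ^ kk : ℕ) : ℝ))⁻¹) * ((((L ^ r * L ^ kk : ℕ) : ℝ))⁻¹)) →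
        2 * ((1 + Fintype.card (Fin (d + 1))) * ((3 + 2 * ((d : ℝ) + 1)) * rA)) ≤ 1 →
        (14 * Real.exp 1 * (1 + Fintype.card (Fin (d + 1))) * basisConst e * ((1 + Fintype.card (Fin (d + 1))) * ((3 + 2 * ((d : ℝ) + 1)) * rA))) * (1 + Fintype.card (Fin (d + 1) ⊕ Fin (d + 1))) ≤ R₀ →
        HasMaj (CvNorm d L mv kk hL ι) (BlockNorm.ofBlocks (unitTorusGeo L kk (cvM d L mv kk hL)) (liftBlk (cvBlk d L mv kk hL ∘ kingPrV L kk r (cvM d L mv kk hL)) ι)) (idef (pull (liftMap (kingPrV L kk r (cvM d L mv kk hL)) ι)) (pull (liftMap (kingPrV L kk r (cvM d L mv kk hL)) ι))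
            (Sum.elim (fun μ => fgrad ((((L ^ r * L ^ kk : ℕ) : ℝ))⁻¹)⁻¹ (liftEquiv (bshiftEquiv (cvM d L mv kk hL) (L ^ r * L ^ kk) μ) ι)) (fun μ => bgrad ((((L ^ r * L ^ kk : ℕ) : ℝ))⁻¹)⁻¹ (liftEquiv (bshiftEquiv (cvM d L mv kk hL) (L ^ r * L ^ kk) μ) ι)) j ∘ₗ
              cvGlued' d L mv kk r hL a ((((L ^ r * L ^ kk : ℕ) : ℝ))⁻¹) ι e (fun _ _ => (1 : Matrix mm mm ℂ)) (fun μ x' => NormedSpace.exp (((((L ^ r * L ^ kk : ℕ) : ℝ))⁻¹) • A' μ x')) (cvNL' d L mv kk r hL a ι) (fun _ => 0))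
            (Sum.elim (fun μ => fgrad ((((L ^ kk : ℕ) : ℝ))⁻¹)⁻¹ (liftEquiv (bshiftEquiv (cvM d L mv kk hL) (L ^ kk) μ) ι)) (fun μ => bgrad ((((L ^ kk : ℕ) : ℝ))⁻¹)⁻¹ (liftEquiv (bshiftEquiv (cvM d L mv kk hL) (L ^ kk) μ) ι)) j ∘ₗ
              cvGlued d L mv kk hL a ((((L ^ kk : ℕ) : ℝ))⁻¹) ι e (fun _ _ => (1 : Matrix mm mm ℂ)) (fun μ x => NormedSpace.exp (((((L ^ kk : ℕ) : ℝ))⁻¹) • gavgM (Matrix mm mm ℂ) (Fin (d + 1)) (kingPrV L kk r (cvM d L mv kk hL)) A' μ x)) (cvNL d L mv kk hL a ι) (fun _ => 0)))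
          (fun y y' => D * ((((L ^ kk : ℕ) : ℝ)) ^ (-(1 / 16 : ℝ)) + (14 * Real.exp 1 * (1 + Fintype.card (Fin (d + 1))) * basisConst e * ((1 + Fintype.card (Fin (d + 1))) * ((3 + 2 * ((d : ℝ) + 1)) * rA))) * (1 + Fintype.card (Fin (d + 1) ⊕ Fin (d + 1))) * ((((L ^ kk : ℕ) : ℝ))⁻¹)) *
            Real.exp (-(δ / 16 * (unitTorusGeo L kk (cvM d L mv kk hL)).dist y y'))) := by
  have hLpos : 0 < L := Nat.pos_of_ne_zero (NeZero.ne L)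
  have hL1 : (1 : ℝ) ≤ L := by exact_mod_cast hLpos
  obtain ⟨δ, w₀, R₀, θ₀, D, hδ, hR₀, hθ₀, H⟩ := one_idef_jet_cvGlued (d := d) hL hL7 ha ι
  refine ⟨δ, w₀, R₀, D, hδ, hR₀, fun mv kk r j hk hw₀ => ?_⟩
  intro mm _ _ e he A' hA' rA hrA h1 h2 h3 hr2 hRle
  -- the two spacings
  have hkpos : (0 : ℝ) < ((L ^ kk : ℕ) : ℝ) := Nat.cast_pos.mpr (pow_pos hLpos kk)
  have hrkpos : (0 : ℝ) < ((L ^ r * L ^ kk : ℕ) : ℝ) := Nat.cast_pos.mpr (Nat.mul_pos (pow_pos hLpos r) (pow_pos hLpos kk))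
  have hη : (0 : ℝ) < ((((L ^ kk : ℕ) : ℝ))⁻¹) := inv_pos.mpr hkpos
  have hη' : (0 : ℝ) < ((((L ^ r * L ^ kk : ℕ) : ℝ))⁻¹) := inv_pos.mpr hrkpos
  have hN : ((((L ^ kk : ℕ) : ℝ))⁻¹) = ((L ^ r : ℕ) : ℝ) * ((((L ^ r * L ^ kk : ℕ) : ℝ))⁻¹) := by
    have hr0 : ((L ^ r : ℕ) : ℝ) ≠ 0 := Nat.cast_ne_zero.mpr (pow_ne_zero _ (NeZero.ne L))
    rw [Nat.cast_mul]; field_simp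
  have hη1 : ((((L ^ kk : ℕ) : ℝ))⁻¹) ≤ 1 := inv_le_one_of_one_le₀ (by exact_mod_cast Nat.one_le_pow kk L hLpos)
  have hC₀ : (0 : ℝ) ≤ 2 * ((d : ℝ) + 1) := by positivity
  have hCθ : ((2 * ((d + 1) * (L ^ r - 1)) : ℕ) : ℝ) * ((((L ^ r * L ^ kk : ℕ) : ℝ))⁻¹) ≤ 2 * ((d : ℝ) + 1) * ((((L ^ kk : ℕ) : ℝ))⁻¹) := by
    have hsub : (((L ^ r - 1 : ℕ)) : ℝ) ≤ ((L ^ r : ℕ) : ℝ) := by exact_mod_cast Nat.sub_le _ _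
    have hcast : ((2 * ((d + 1) * (L ^ r - 1)) : ℕ) : ℝ) = 2 * ((d : ℝ) + 1) * (((L ^ r - 1 : ℕ)) : ℝ) := by push_cast; ring
    rw [hcast, hN]
    have hr0 : (0 : ℝ) < ((L ^ r : ℕ) : ℝ) := Nat.cast_pos.mpr (pow_pos hLpos r)
    calc 2 * ((d : ℝ) + 1) * (((L ^ r - 1 : ℕ)) : ℝ) * ((((L ^ r * L ^ kk : ℕ) : ℝ))⁻¹) ≤ 2 * ((d : ℝ) + 1) * ((L ^ r : ℕ) : ℝ) * ((((L ^ r * L ^ kk : ℕ) : ℝ))⁻¹) :=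
          mul_le_mul_of_nonneg_right (mul_le_mul_of_nonneg_left hsub hC₀) hη'.le
      _ = 2 * ((d : ℝ) + 1) * (((L ^ r : ℕ) : ℝ) * ((((L ^ r * L ^ kk : ℕ) : ℝ))⁻¹)) := by ring
  -- the geometry of King's bond pairing on the cover
  have hcomm := fun μ κ (x : CvX' d L mv kk r hL) => bshiftEquiv_comm (cvM d L mv kk hL) (L ^ r * L ^ kk) μ κ x
  have hconn := fun (f : CvX' d L mv kk r hL → Matrix mm mm ℂ) (β : ℝ)
      (hf : ∀ κ x, ‖f (bshiftEquiv (cvM d L mv kk hL) (L ^ r * L ^ kk) κ x) - f x‖ ≤ β) => fibre_conn_kingPrV L kk r (cvM d L mv kk hL) f β hf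
  have hblk := fun μ (x' : CvX' d L mv kk r hL) => kingPrV_bshiftEquiv_pow L kk r (cvM d L mv kk hL) μ x'
  -- skewness, in the matrix algebra and in coordinates
  have hAm : ∀ μ x, (gavgM (Matrix mm mm ℂ) (Fin (d + 1)) (kingPrV L kk r (cvM d L mv kk hL)) A' μ x)ᴴ = -gavgM (Matrix mm mm ℂ) (Fin (d + 1)) (kingPrV L kk r (cvM d L mv kk hL)) A' μ x := gavgM_conjTranspose_of_skew (kingPrV L kk r (cvM d L mv kk hL)) hA'
  have hA'c := fun μ x' => coordMat_adCLM_transpose_eq_neg_of_conjTranspose e he (hA' μ x')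
  have hAmc := fun μ x => coordMat_adCLM_transpose_eq_neg_of_conjTranspose e he (hAm μ x)
  -- the fifteen letters at rate `θ = η`
  obtain ⟨hc, hcA, hc', hcA', hfc, hfA, -, -, -, -, -, -, -, -, -⟩ :=
    twoSidedLetters_curvCoef_one_of_meanGauge e (π := (kingPrV L kk r (cvM d L mv kk hL))) (s := bshiftEquiv (cvM d L mv kk hL) (L ^ kk))
      (s' := bshiftEquiv (cvM d L mv kk hL) (L ^ r * L ^ kk)) (N := L ^ r) (θ := ((((L ^ kk : ℕ) : ℝ))⁻¹)) (Cπ := ((2 * ((d + 1) * (L ^ r - 1)) : ℕ) : ℝ)) (C₀ := 2 * ((d : ℝ) + 1))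
      hcomm hconn hblk hη' hN hη hη1 le_rfl hC₀ hCθ hrA hr2 hA'c hAmc h1 h2 h3
  -- currency: curved-at-flat-base coefficients = exact transport coefficients; the transporter field at `w ≡ 1`
  rw [curvCoefC_one, curvCoefA_one, ← conj_one_exp_eq_expTrField e ((((L ^ kk : ℕ) : ℝ))⁻¹) hAm] at hc hcA
  rw [curvCoefC_one, curvCoefA_one, ← conj_one_exp_eq_expTrField e ((((L ^ r * L ^ kk : ℕ) : ℝ))⁻¹) hA'] at hc' hcA'
  rw [curvCoefC_one, curvCoefC_one, ← conj_one_exp_eq_expTrField e ((((L ^ kk : ℕ) : ℝ))⁻¹) hAm, ← conj_one_exp_eq_expTrField e ((((L ^ r * L ^ kk : ℕ) : ℝ))⁻¹) hA'] at hfc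
  rw [curvCoefA_one, curvCoefA_one, ← conj_one_exp_eq_expTrField e ((((L ^ kk : ℕ) : ℝ))⁻¹) hAm, ← conj_one_exp_eq_expTrField e ((((L ^ r * L ^ kk : ℕ) : ℝ))⁻¹) hA'] at hfA
  -- the cut fits (`χ′ = χ∘π̂`, `|χ| ≤ 1`)
  have hχ : ∀ (k : Fin (d + 1) → ZMod (2 * L)) (x' : CvX' d L mv kk r hL), cvChi' d L mv kk r hL k x' = cvChi d L mv kk hL k ((kingPrV L kk r (cvM d L mv kk hL)) x') :=
    fun k x' => (chiCube_kingPrV L kk r _ _ x').symm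
  have hχ1 : ∀ (k : Fin (d + 1) → ZMod (2 * L)) (x : CvX d L mv kk hL), |cvChi d L mv kk hL k x| ≤ 1 := fun k x => abs_chiCube_le_one _ x
  -- nonnegativity of the scale
  have hκ0 : 0 ≤ basisConst e := basisConst_nonneg e
  have hS0 : 0 ≤ (14 * Real.exp 1 * (1 + Fintype.card (Fin (d + 1))) * basisConst e * ((1 + Fintype.card (Fin (d + 1))) * ((3 + 2 * ((d : ℝ) + 1)) * rA))) := by positivity
  have hSη0 : 0 ≤ (14 * Real.exp 1 * (1 + Fintype.card (Fin (d + 1))) * basisConst e * ((1 + Fintype.card (Fin (d + 1))) * ((3 + 2 * ((d : ℝ) + 1)) * rA))) * ((((L ^ kk : ℕ) : ℝ))⁻¹) := mul_nonneg hS0 hη.le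
  have hmain := H mv kk r j hk hw₀ e he (fun μ x => NormedSpace.exp (((((L ^ kk : ℕ) : ℝ))⁻¹) • gavgM (Matrix mm mm ℂ) (Fin (d + 1)) (kingPrV L kk r (cvM d L mv kk hL)) A' μ x)) (fun μ x' => NormedSpace.exp (((((L ^ r * L ^ kk : ℕ) : ℝ))⁻¹) • A' μ x')) (cvNL d L mv kk hL a ι) (cvNL' d L mv kk r hL a ι) (fun _ => 0) (fun _ => 0)
    (14 * Real.exp 1 * (1 + Fintype.card (Fin (d + 1))) * basisConst e * ((1 + Fintype.card (Fin (d + 1))) * ((3 + 2 * ((d : ℝ) + 1)) * rA))) 0 0 0 ((14 * Real.exp 1 * (1 + Fintype.card (Fin (d + 1))) * basisConst e * ((1 + Fintype.card (Fin (d + 1))) * ((3 + 2 * ((d : ℝ) + 1)) * rA))) * ((((L ^ kk : ℕ) : ℝ))⁻¹)) 0 ((14 * Real.exp 1 * (1 + Fintype.card (Fin (d + 1))) * basisConst e * ((1 + Fintype.card (Fin (d + 1))) * ((3 + 2 * ((d : ℝ) + 1)) * rA))) * ((((L ^ kk : ℕ) : ℝ))⁻¹) * (1 + Fintype.card (Fin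 (d + 1) ⊕ Fin (d + 1))) + 0)
    hS0 le_rfl le_rfl hSη0 le_rfl (by rw [add_zero]; exact hRle) le_rfl hθ₀.le
    (fun k => conj_one_eq_sub_zero e (cvNL d L mv kk hL a ι)) (fun k => conj_one_eq_sub_zero e (cvNL' d L mv kk r hL a ι))
    (fun k x _ i => hc x i) (fun k j' x _ i => hcA j' x i) (fun k x' _ i => hc' x' i) (fun k j' x' _ i => hcA' j' x' i)
    (fun k x' i => rowFit_smul_of_rowFit (kingPrV L kk r (cvM d L mv kk hL)) (hχ k) (hχ1 k) _ _ hfc x' i)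
    (fun k j' x' i => rowFit_smul_of_rowFit₂ (kingPrV L kk r (cvM d L mv kk hL)) (hχ k) (hχ1 k) _ _ hfA j' x' i)
    (fun k => hasMaj_sandwich_zero _ _ _ _ le_rfl _) (fun k => hasMaj_sandwich_zero _ _ _ _ le_rfl _) (fun k => hasMaj_idef_sandwich_zero _ _ _ _ _ _ _ _ le_rfl _)
    (fun k => hasMaj_sandwich_zero _ _ _ _ le_rfl _) (fun k => hasMaj_sandwich_zero _ _ _ _ le_rfl _) (fun k => hasMaj_idef_sandwich_zero _ _ _ _ _ _ _ _ le_rfl _)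
  refine hmain.mono fun y y' => le_of_eq ?_
  ring

end Defect

end Summit.QuantumFields.YangMills.BalabanUVNodes.N15.Gluing

end
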